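import Summits.NavierStokesRegularity.NavierStokesRegularity.Theorems.StrainClockBudgetedDefs
import HarnessLib

/-!
# StrainClockBudgetedCompositions — door family S41 «BudgetedClock»: the engine (§2)

P0-41 part 2 of 3: §2 (`budgetedSlab_bound` = the budgeted level-charged weighted one-slab bound: S40's Riccati barrier times
`e^{Φ}`) of nsreg-p1 g32's `r39/Sketch42.lean` sha16 7255af488b752fb6 (ROUND-39 S41 «BudgetedClock», memo v1.1 2ec8562e2824807f),
byte-identical; imports part 1 `…Theorems.StrainClockBudgetedDefs`; cut prepared by ns-s29-p2 g5 per memo §8,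
`--supports stmt-NavierStokesRegularity-0056 --as helper`.  UNCONDITIONAL in the tree's sense (plates are binders of the theorem).

HONEST FRAME: door family S41 «BudgetedClock» = budgeted strain-clock CRITERIA (conditional statements about HYPOTHETICAL blow-up
profiles; the content is the quantitative BKM-shaped residual); items 0056 `NoTypeII`, 10661 and NS regularity are NOT proved;
nothing here is a route or a summit statement.
-/

noncomputable section

open MeasureTheory Set Function Filter Metric Real InnerProductSpace
open _root_.Topology
open scoped ENNReal NNReal RealInnerProductSpace ContDiff Laplacian Interval
open Literature.Analysis Literature.Analysis.FluidPDE
open Literature.Analysis.FluidPDE.VorticityDirectionDynamics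

set_option linter.dupNamespace false

namespace Summit.NavierStokesRegularity.NavierStokesRegularity.Theorems.StrainDoors

open Summit.NavierStokesRegularity.NavierStokesRegularity.Theorems.ArgmaxDoors

-- nested operator types (second derivatives)
set_option maxSynthPendingDepth 3

/-! ## §2 Engine: the budgeted level-charged weighted one-slab bound -/

/-- **THE BUDGETED LEVEL-CHARGED WEIGHTED ONE-SLAB BOUND** (engine of D6; S40's `driftSlab_bound` with the exponential
factor). On a closed slab `[s₁,s₂]`: classical solution with `‖∇u‖ ≤ K`; budget `0 ≤ Φ ≤ β`, `Φ′ = b`; total feed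
`H + √ε|u|q ≤ c q² + b q` at the charged exact `ε`-penalised maximisers whose weighted strain exceeds `ℓ`, at times
`s ∈ (s₁,s₂]`. THEN `(1+ε|x|²)⁻¹⟪∇u(s₂,x)e,e⟫ ≤ e^{β}(ℓ + η/κ + (L'⁻¹ + κ(s₂−s₁))⁻¹)`, `η = 6νε`, `κ = 1 − c`,
`L' = max K 1`. Barrier `B = e^{Φ}(a + D⁻¹)`, `a = ℓ + η/κ`, `D = L'⁻¹ + κ(s − s₁)`, `φ = −κB + η + b`:
`φB = e^{Φ}[−κe^{Φ}B₀² + ηB₀ + bB₀] ≤ e^{Φ}[−κB₀² + ηB₀ + bB₀] ≤ e^{Φ}[bB₀ − κD⁻²] = B'` (`e^{Φ} ≥ 1`). [folklore] -/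
theorem budgetedSlab_bound (hFr : StrainFrameOn) (hW : StrainThresholdWeightedOn)
    {ν K ε ℓ c β s₁ s₂ : ℝ} {Φ b : ℝ → ℝ} (hν : 0 < ν) (hε : 0 < ε) (hℓ : 0 ≤ ℓ) (hc : c < 1) (h12 : s₁ < s₂)
    {u : ℝ → (EuclideanSpace ℝ (Fin 3)) → (EuclideanSpace ℝ (Fin 3))} {p : ℝ → (EuclideanSpace ℝ (Fin 3)) → ℝ}
    (hsol : IsClassicalNSSolutionOn (Icc s₁ s₂) ν 0 u p)
    (hK : ∀ s ∈ Icc s₁ s₂, ∀ x : EuclideanSpace ℝ (Fin 3), ‖fderiv ℝ (u s) x‖ ≤ K)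
    (hΦ : ∀ s ∈ Icc s₁ s₂, 0 ≤ Φ s ∧ Φ s ≤ β ∧ HasDerivAt Φ (b s) s)
    (hhyp : ∀ s ∈ Ioc s₁ s₂, ∀ (x e : EuclideanSpace ℝ (Fin 3)), IsStrainPenalisedArgmax ε u s x e →
      ℓ < (1 + ε * ‖x‖ ^ 2)⁻¹ * strainQuad u s x e →
      strainFeed u p s x e + Real.sqrt ε * ‖u s x‖ * strainQuad u s x e ≤
        c * strainQuad u s x e ^ 2 + b s * strainQuad u s x e) :
    ∀ (x e : EuclideanSpace ℝ (Fin 3)), ‖e‖ = 1 →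
      (1 + ε * ‖x‖ ^ 2)⁻¹ * strainQuad u s₂ x e ≤
        Real.exp β * (ℓ + 6 * ν * ε / (1 - c) + ((max K 1)⁻¹ + (1 - c) * (s₂ - s₁))⁻¹) := by
  intro x e he
  set κ : ℝ := 1 - c with hκ
  have hκ0 : 0 < κ := by rw [hκ]; linarith
  set η : ℝ := 6 * ν * ε with hη
  have hη0 : 0 ≤ η := by rw [hη]; positivity
  set a : ℝ := ℓ + η / κ with ha
  have ha0 : 0 ≤ a := add_nonneg hℓ (div_nonneg hη0 hκ0.le)
  have hℓa : ℓ ≤ a := by have := div_nonneg hη0 hκ0.le; rw [ha]; linarith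
  have hκa : κ * a = κ * ℓ + η := by rw [ha]; field_simp
  set L' : ℝ := max K 1 with hL'
  have hL'0 : 0 < L' := lt_of_lt_of_le one_pos (le_max_right _ _)
  have hKb : ∀ s ∈ Icc s₁ s₂, ∀ y : EuclideanSpace ℝ (Fin 3), ‖fderiv ℝ (u s) y‖ ≤ L' :=
    fun s hs y => (hK s hs y).trans (le_max_left _ _)
  -- the weight
  have hwpos : ∀ y : EuclideanSpace ℝ (Fin 3), 0 < (1 + ε * ‖y‖ ^ 2)⁻¹ := fun y => by positivity
  have hw1 : ∀ y : EuclideanSpace ℝ (Fin 3), (1 + ε * ‖y‖ ^ 2)⁻¹ ≤ 1 := fun y =>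
    inv_le_one_of_one_le₀ (by nlinarith [sq_nonneg ‖y‖, hε.le])
  -- the exponential factor
  set E : ℝ → ℝ := fun s => Real.exp (Φ s) with hE
  have hEpos : ∀ s, 0 < E s := fun s => Real.exp_pos _
  have hE1 : ∀ s ∈ Icc s₁ s₂, 1 ≤ E s := fun s hs => Real.one_le_exp (hΦ s hs).1
  have hEβ : ∀ s ∈ Icc s₁ s₂, E s ≤ Real.exp β := fun s hs => Real.exp_le_exp.2 (hΦ s hs).2.1
  -- the barrier
  set D : ℝ → ℝ := fun s => L'⁻¹ + κ * (s - s₁) with hD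
  have hDpos : ∀ s ∈ Icc s₁ s₂, 0 < D s := fun s hs => by
    have h1 : 0 ≤ κ * (s - s₁) := mul_nonneg hκ0.le (sub_nonneg.2 hs.1)
    have h2 : 0 < L'⁻¹ := inv_pos.2 hL'0
    simp only [hD]
    linarith
  set B₀ : ℝ → ℝ := fun s => a + (D s)⁻¹ with hB₀
  set B : ℝ → ℝ := fun s => E s * B₀ s with hB
  set B' : ℝ → ℝ := fun s => E s * b s * B₀ s + E s * (-κ / (D s) ^ 2) with hB'
  set φ : ℝ → ℝ := fun s => -κ * B s + η + b s with hφ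
  have hB₀a : ∀ s ∈ Icc s₁ s₂, a < B₀ s := fun s hs => by
    simp only [hB₀]
    linarith [inv_pos.2 (hDpos s hs)]
  have hB₀pos : ∀ s ∈ Icc s₁ s₂, 0 < B₀ s := fun s hs => lt_of_le_of_lt ha0 (hB₀a s hs)
  have hB₀B : ∀ s ∈ Icc s₁ s₂, B₀ s ≤ B s := fun s hs => by
    have := mul_le_mul_of_nonneg_right (hE1 s hs) (hB₀pos s hs).le
    simpa [hB] using this
  have hBa : ∀ s ∈ Icc s₁ s₂, a < B s := fun s hs => (hB₀a s hs).trans_le (hB₀B s hs)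
  have hBpos : ∀ s ∈ Icc s₁ s₂, 0 < B s := fun s hs => lt_of_le_of_lt ha0 (hBa s hs)
  have hΦc : ∀ s ∈ Icc s₁ s₂, ContinuousAt Φ s := fun s hs => (hΦ s hs).2.2.continuousAt
  have hBc : ContinuousOn B (Icc s₁ s₂) := by
    have hDc : Continuous D :=
      continuous_const.add (continuous_const.mul (continuous_id.sub continuous_const))
    have hB₀c : ContinuousOn B₀ (Icc s₁ s₂) :=
      continuousOn_const.add (hDc.continuousOn.inv₀ fun s hs => (hDpos s hs).ne')
    have hEc : ContinuousOn E (Icc s₁ s₂) := fun s hs => (hΦc s hs).rexp.continuousWithinAt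
    exact hEc.mul hB₀c
  have hBd : ∀ s ∈ Icc s₁ s₂, HasDerivWithinAt B (B' s) (Icc s₁ s₂) s := by
    intro s hs
    have hDd : HasDerivAt D κ s := by
      have h1 : HasDerivAt (fun r : ℝ => L'⁻¹ + κ * (r - s₁)) (0 + κ * 1) s :=
        (hasDerivAt_const s L'⁻¹).add (((hasDerivAt_id s).sub_const s₁).const_mul κ)
      rw [zero_add, mul_one] at h1
      exact h1
    have hB₀d : HasDerivAt B₀ (-κ / (D s) ^ 2) s := (hDd.inv (hDpos s hs).ne').const_add a
    have hEd : HasDerivAt E (Real.exp (Φ s) * b s) s := (hΦ s hs).2.2.exp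
    have h := hEd.mul hB₀d
    refine h.hasDerivWithinAt.congr_deriv ?_
    simp only [hB', hE, mul_assoc]
  have hsuper : ∀ s ∈ Icc s₁ s₂, φ s * B s ≤ B' s := by
    intro s hs
    have hD0 : D s ≠ 0 := (hDpos s hs).ne'
    have hd : 0 < (D s)⁻¹ := inv_pos.2 (hDpos s hs)
    have hEs := hEpos s
    have hE1s := hE1 s hs
    have hB₀s := hB₀pos s hs
    -- S40's supersolution inequality for the Riccati barrier `B₀ = a + D⁻¹`
    have hold : (-κ * B₀ s + η) * B₀ s ≤ -κ / (D s) ^ 2 := by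
      have h1 : (-κ * B₀ s + η) * B₀ s = -κ * ((ℓ + (D s)⁻¹) * (a + (D s)⁻¹)) := by
        simp only [hB₀]
        linear_combination (-(a + (D s)⁻¹)) * hκa
      have h2 : -κ / (D s) ^ 2 = -κ * (D s)⁻¹ ^ 2 := by
        rw [div_eq_mul_inv, ← inv_pow]
      rw [h1, h2]
      have h3 : (D s)⁻¹ ^ 2 ≤ (ℓ + (D s)⁻¹) * (a + (D s)⁻¹) := by
        nlinarith [mul_nonneg hℓ ha0, mul_nonneg hℓ hd.le, mul_nonneg ha0 hd.le]
      nlinarith [mul_le_mul_of_nonneg_left h3 hκ0.le]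
    -- the exponential factor only helps: `−κ E B₀² ≤ −κ B₀²`
    have hsq : -κ * (E s * B₀ s) * B₀ s ≤ -κ * B₀ s * B₀ s := by
      have : B₀ s * B₀ s ≤ E s * B₀ s * B₀ s := by nlinarith
      nlinarith
    have h1 : φ s * B s = E s * ((-κ * (E s * B₀ s) + η + b s) * B₀ s) := by
      simp only [hφ, hB]; ring
    have h2 : B' s = E s * (b s * B₀ s + -κ / (D s) ^ 2) := by
      simp only [hB']; ring
    rw [h1, h2]
    apply mul_le_mul_of_nonneg_left _ hEs.le
    nlinarith [hold, hsq]
  -- growth at the charged exact penalised maximisers above the level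
  have hrate : ∀ s ∈ Ioc s₁ s₂, ∀ (x e : EuclideanSpace ℝ (Fin 3)), ‖e‖ = 1 →
      (∀ (y e' : EuclideanSpace ℝ (Fin 3)), ‖e'‖ = 1 →
        (1 + ε * ‖y‖ ^ 2)⁻¹ * strainQuad u s y e' ≤ (1 + ε * ‖x‖ ^ 2)⁻¹ * strainQuad u s x e) →
      B s < (1 + ε * ‖x‖ ^ 2)⁻¹ * strainQuad u s x e →
      (1 + ε * ‖x‖ ^ 2)⁻¹ * strainRateOn (Icc s₁ s₂) u s x e ≤
        φ s * ((1 + ε * ‖x‖ ^ 2)⁻¹ * strainQuad u s x e) := by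
    intro s hs x e he hpen hbig
    have hsI : s ∈ Icc s₁ s₂ := ⟨hs.1.le, hs.2⟩
    have hBs := hBpos s hsI
    have hwx := hwpos x
    have hw1x := hw1 x
    have hQ0 : 0 < (1 + ε * ‖x‖ ^ 2)⁻¹ * strainQuad u s x e := hBs.trans hbig
    have hℓQ : ℓ < (1 + ε * ‖x‖ ^ 2)⁻¹ * strainQuad u s x e :=
      lt_of_le_of_lt hℓa ((hBa s hsI).trans hbig)
    have hq0 : 0 < strainQuad u s x e := by
      by_contra hle
      push Not at hle
      have : (1 + ε * ‖x‖ ^ 2)⁻¹ * strainQuad u s x e ≤ 0 := mul_nonpos_of_nonneg_of_nonpos hwx.le hle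
      linarith
    have hsm : ContDiff ℝ ∞ (u s) := hsol.smooth_velocity.contDiff_slice hsI
    have heq := hFr ν s₁ s₂ h12 u p hsol s hsI x e
    have hE' := strainGrowthWeighted ν ε hν.le hε (u s) (p s) hsm x e he (fun y => hpen y e he) hq0.le _ heq
    have hfeed := hhyp s hs x e ⟨he, hpen⟩ hℓQ
    have h1 : strainRateOn (Icc s₁ s₂) u s x e ≤ -(strainQuad u s x e) ^ 2 + strainFeed u p s x e +
        (6 * ν * ε + Real.sqrt ε * ‖u s x‖) * strainQuad u s x e := by
      unfold strainRateOn strainQuad strainFeed pressureHess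
      linarith [hE']
    have hexp : (6 * ν * ε + Real.sqrt ε * ‖u s x‖) * strainQuad u s x e =
        η * strainQuad u s x e + Real.sqrt ε * ‖u s x‖ * strainQuad u s x e := by
      rw [hη]; ring
    have h2 : strainRateOn (Icc s₁ s₂) u s x e ≤
        -κ * strainQuad u s x e ^ 2 + η * strainQuad u s x e + b s * strainQuad u s x e := by
      have h3 : -(strainQuad u s x e) ^ 2 + c * strainQuad u s x e ^ 2 = -κ * strainQuad u s x e ^ 2 := by
        rw [hκ]; ring
      linarith [h1, hexp, hfeed, h3]
    have h4 : (1 + ε * ‖x‖ ^ 2)⁻¹ * strainRateOn (Icc s₁ s₂) u s x e ≤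
        (1 + ε * ‖x‖ ^ 2)⁻¹ *
          (-κ * strainQuad u s x e ^ 2 + η * strainQuad u s x e + b s * strainQuad u s x e) :=
      mul_le_mul_of_nonneg_left h2 hwx.le
    have hwq : (1 + ε * ‖x‖ ^ 2)⁻¹ * strainQuad u s x e ≤ strainQuad u s x e :=
      mul_le_of_le_one_left hq0.le hw1x
    have hBq : B s ≤ strainQuad u s x e := hbig.le.trans hwq
    have h5 : κ * ((1 + ε * ‖x‖ ^ 2)⁻¹ * strainQuad u s x e) * B s ≤
        κ * ((1 + ε * ‖x‖ ^ 2)⁻¹ * strainQuad u s x e) * strainQuad u s x e :=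
      mul_le_mul_of_nonneg_left hBq (mul_nonneg hκ0.le hQ0.le)
    have h6 : (1 + ε * ‖x‖ ^ 2)⁻¹ *
          (-κ * strainQuad u s x e ^ 2 + η * strainQuad u s x e + b s * strainQuad u s x e) =
        -(κ * ((1 + ε * ‖x‖ ^ 2)⁻¹ * strainQuad u s x e) * strainQuad u s x e) +
          η * ((1 + ε * ‖x‖ ^ 2)⁻¹ * strainQuad u s x e) +
          b s * ((1 + ε * ‖x‖ ^ 2)⁻¹ * strainQuad u s x e) := by ring
    have h7 : φ s * ((1 + ε * ‖x‖ ^ 2)⁻¹ * strainQuad u s x e) =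
        -(κ * ((1 + ε * ‖x‖ ^ 2)⁻¹ * strainQuad u s x e) * B s) +
          η * ((1 + ε * ‖x‖ ^ 2)⁻¹ * strainQuad u s x e) +
          b s * ((1 + ε * ‖x‖ ^ 2)⁻¹ * strainQuad u s x e) := by
      simp only [hφ]; ring
    rw [h7]
    rw [h6] at h4
    linarith [h4, h5]
  have hinit : ∀ (y e' : EuclideanSpace ℝ (Fin 3)), ‖e'‖ = 1 →
      (1 + ε * ‖y‖ ^ 2)⁻¹ * strainQuad u s₁ y e' ≤ B s₁ := by
    intro y e' he'
    have hs₁ : s₁ ∈ Icc s₁ s₂ := ⟨le_rfl, h12.le⟩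
    have h1 : B₀ s₁ = a + L' := by simp only [hB₀, hD, sub_self, mul_zero, add_zero, inv_inv]
    have h0 : a + L' ≤ B s₁ := by
      have := hB₀B s₁ hs₁
      rw [h1] at this
      exact this
    refine le_trans ?_ h0
    by_cases hq : 0 ≤ strainQuad u s₁ y e'
    · calc (1 + ε * ‖y‖ ^ 2)⁻¹ * strainQuad u s₁ y e' ≤ strainQuad u s₁ y e' :=
            mul_le_of_le_one_left hq (hw1 y)
        _ ≤ L' := (strainQuad_le_opNorm u s₁ y he').trans (hKb s₁ hs₁ y)
        _ ≤ a + L' := by linarith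
    · push Not at hq
      have : (1 + ε * ‖y‖ ^ 2)⁻¹ * strainQuad u s₁ y e' ≤ 0 :=
        mul_nonpos_of_nonneg_of_nonpos (hwpos y).le hq.le
      linarith
  have hs₂ : s₂ ∈ Icc s₁ s₂ := ⟨h12.le, le_rfl⟩
  have hmain := hW ν s₁ s₂ ε hν h12 hε u p hsol ⟨L', hKb⟩ B B' φ hBc hBpos hBd hsuper hrate hinit s₂ hs₂ x e he
  have hfin : B s₂ ≤ Real.exp β * B₀ s₂ := mul_le_mul_of_nonneg_right (hEβ s₂ hs₂) (hB₀pos s₂ hs₂).le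
  have h := hmain.trans hfin
  simpa only [hB₀, hD, ha, hη, hκ, hL'] using h


end Summit.NavierStokesRegularity.NavierStokesRegularity.Theorems.StrainDoors

end
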